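import Summits.HubbardSuperconductivity.HubbardSuperconductivity.Theses.HyperoctahedralMott
import Summits.HubbardSuperconductivity.HubbardSuperconductivity.Theorems.HyperoctahedralMottCompleteGraphAnchorIdentity
import Summits.HubbardSuperconductivity.HubbardSuperconductivity.Theorems.HyperoctahedralMottCompleteGraphAnchorMinimiser

/-!
# Route `HyperoctahedralMott`, support `CompleteGraphAnchor` (item stmt-HubbardSuperconductivity-6677)

The solvable anchor of the route: on the complete graph `K_n` (`n ≥ 2`), for `N ≤ n` electrons and
magnetisation `M = N/2 - k ≥ 0` with `k ≥ 1`, the minimum of the fermionic interchange Laplacian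
`ℒ = Σ_{x<y} (1 - π(xy))` (`π(xy)` the graded site swap) over the Gutzwiller `(N, S^z = M)` sector is

  `n(n-1)/2 - [(n-N+1)(n-N+2)/2 - (N/2-M-1)² - M(N-1)] = nN - 2n + N - (N-k)k - k`.

Proof (files `…CompleteGraphAnchorCAR/Sums/Identity/Blocks/Minimiser`): instead of
Sergeev–Berele–Regev duality the `gl(1|2)` Casimir is written as a sum of squares,
`⟨ψ, ℒψ⟩ = c‖ψ‖² + ‖P C↑†ψ‖² + ‖P C↓†ψ‖² + ‖S⁺ψ‖²` on the sector (`lap_expect_eq`), which gives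
`ℒ ≥ c`; the block state of `exists_minimiser` (one `s`-wave pair delocalised over the holes' block,
`k-1` bond singlets, `2M` aligned spins) is killed by `S⁺` and `P C_σ†`, so `c` is attained. The
closing theorem is `completeGraphAnchor_proof`. [folklore; context: Sarkar 1991, Essler–Korepin 1992
(supersymmetric `t`-`J` = graded permutations), van Dongen–Vollhardt 1989 (complete-graph Hubbard)]
-/

-- the mandated namespace `Summit.<Summit>.<Problem>.Theorems` repeats `HubbardSuperconductivity`
-- (single-problem summit, D-0017), which the `dupNamespace` linter flags on every declaration
set_option linter.dupNamespace false

noncomputable section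

namespace Summit.HubbardSuperconductivity.HubbardSuperconductivity.Theorems.HyperoctahedralMott.Anchor

open Matrix Finset Literature.MathematicalPhysics.QuantumLattice HubbardWave0
open scoped ComplexOrder

/-! ### Assembly: the sector minimum on the complete graph -/

section Assembly

variable {Λ : Type*} [LinearOrder Λ] [Fintype Λ]

/-- Membership in the Gutzwiller `(N, S^z = M)` sector, unpacked. [folklore] -/
theorem mem_gutzwillerSector_iff (ψ : Fock (Orb Λ)) (N : ℕ) (M : ℝ) :
    ψ ∈ szSector N M ⊓ Module.End.eigenspace
        (Matrix.toLin' (gutzwillerProj : Matrix (Finset (Orb Λ)) (Finset (Orb Λ)) ℂ)) 1 ↔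
      IsNParticle N ψ ∧ spinZ *ᵥ ψ = (M : ℂ) • ψ ∧ IsGutzwiller ψ := by
  rw [Submodule.mem_inf, mem_szSector_iff, Module.End.mem_eigenspace_iff, Matrix.toLin'_apply, one_smul,
    gutzwillerProj_mulVec_eq_self_iff, and_assoc]

/-- **Lower bound and equality case of the interchange Laplacian on a Gutzwiller sector.** For a
Gutzwiller `N`-particle `S^z = M` eigenvector with `N = Nup + Ndn`, `2M = Nup - Ndn`:
`Re ⟨ψ, ℒ ψ⟩ ≥ c · ‖ψ‖²`, `c = nN - 2n + N - Nup·Ndn - Ndn`, with equality when `S⁺ψ = 0` and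
`P C_σ† ψ = 0` for both spins. [folklore] -/
theorem lap_re_expect {ψ : Fock (Orb Λ)} (hG : IsGutzwiller ψ) {N : ℕ} (hN : IsNParticle N ψ)
    {M : ℝ} (hS : spinZ *ᵥ ψ = (M : ℂ) • ψ) {Nup Ndn : ℕ} (hsum : Nup + Ndn = N)
    (hM : 2 * M = (Nup : ℝ) - Ndn) :
    ((Fintype.card Λ : ℝ) * (Nup + Ndn) - 2 * (Fintype.card Λ) + (Nup + Ndn) - Nup * Ndn - Ndn) *
        (star ψ ⬝ᵥ ψ).re ≤
      (star ψ ⬝ᵥ (((1 / 2 : ℂ) • ∑ x : Λ, ∑ y : Λ,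
        (if (⊤ : SimpleGraph Λ).Adj x y then (1 - siteSwap x y) else 0)) *ᵥ ψ)).re ∧
    (spinPlus *ᵥ ψ = 0 → gutzwillerProj *ᵥ ((∑ x : Λ, creation (orb x 0)) *ᵥ ψ) = 0 →
      gutzwillerProj *ᵥ ((∑ x : Λ, creation (orb x 1)) *ᵥ ψ) = 0 →
      (star ψ ⬝ᵥ (((1 / 2 : ℂ) • ∑ x : Λ, ∑ y : Λ,
        (if (⊤ : SimpleGraph Λ).Adj x y then (1 - siteSwap x y) else 0)) *ᵥ ψ)).re =
      ((Fintype.card Λ : ℝ) * (Nup + Ndn) - 2 * (Fintype.card Λ) + (Nup + Ndn) - Nup * Ndn - Ndn) *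
        (star ψ ⬝ᵥ ψ).re) := by
  have hc : ∀ s, ψ s ≠ 0 → upCount s = Nup ∧ NagaokaTasaki.downCount s = Ndn := fun s hs =>
    counts_of_sector hG hN hS hsum hM hs
  have hup := sum_numberOp_up_mulVec_of_counts hc
  have hdn := sum_numberOp_down_mulVec_of_counts hc
  have h := lap_expect_eq hG hup hdn
  have hcast : ((Fintype.card Λ : ℂ) * (Nup + Ndn) - 2 * (Fintype.card Λ) + (Nup + Ndn) - Nup * Ndn - Ndn) =
      ((((Fintype.card Λ : ℝ) * (Nup + Ndn) - 2 * (Fintype.card Λ) + (Nup + Ndn) - Nup * Ndn - Ndn : ℝ)) : ℂ) := by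
    push_cast; ring
  rw [hcast] at h
  have hre := congrArg Complex.re h
  rw [Complex.add_re, Complex.add_re, Complex.add_re, Complex.re_ofReal_mul] at hre
  have h0 := star_dotProduct_self_re_nonneg (gutzwillerProj *ᵥ ((∑ x : Λ, creation (orb x 0)) *ᵥ ψ))
  have h1 := star_dotProduct_self_re_nonneg (gutzwillerProj *ᵥ ((∑ x : Λ, creation (orb x 1)) *ᵥ ψ))
  have h2 := star_dotProduct_self_re_nonneg (spinPlus *ᵥ ψ)
  refine ⟨by linarith, fun hsp hq0 hq1 => ?_⟩
  rw [hre, hsp, hq0, hq1]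
  simp

end Assembly

section Fin

/-- **The block structure on `Fin n`.** For `1 ≤ k`, `2k ≤ N ≤ n` there is a labelling of `Fin n`
into blocks `0, …, k-1` (sizes `2, …, 2, n - N + 2`) and a top fiber of size `N - 2k`, with two
designated sites in every block. [folklore] -/
theorem exists_blocks (n N k : ℕ) (hk : 1 ≤ k) (hkN : 2 * k ≤ N) (hNn : N ≤ n) :
    ∃ (label : Fin n → ℕ) (a b : ℕ → Fin n), (∀ x, label x ≤ k) ∧ (∀ j < k, label (a j) = j) ∧
      (∀ j < k, label (b j) = j) ∧ (∀ j < k, a j ≠ b j) ∧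
      (univ.filter fun x => label x = k).card = N - 2 * k := by
  have hn0 : 0 < n := by omega
  refine ⟨fun x => if x.val < (n - N) + 2 * k then min (x.val / 2) (k - 1) else k,
    fun j => ⟨(2 * j) % n, Nat.mod_lt _ hn0⟩, fun j => ⟨(2 * j + 1) % n, Nat.mod_lt _ hn0⟩,
    ?_, ?_, ?_, ?_, ?_⟩
  · intro x
    dsimp only
    split_ifs
    · exact le_trans (min_le_right _ _) (Nat.sub_le _ _)
    · exact le_rfl
  · intro j hj
    have h2j : (2 * j) % n = 2 * j := Nat.mod_eq_of_lt (by omega)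
    dsimp only
    simp only [h2j]
    rw [if_pos (by omega), Nat.mul_div_cancel_left j two_pos, min_eq_left (by omega)]
  · intro j hj
    have h2j : (2 * j + 1) % n = 2 * j + 1 := Nat.mod_eq_of_lt (by omega)
    have hdiv : (2 * j + 1) / 2 = j := by omega
    dsimp only
    simp only [h2j]
    rw [if_pos (by omega), hdiv, min_eq_left (by omega)]
  · intro j hj
    have h2j : 2 * j + 1 < n := by omega
    rw [Ne, Fin.ext_iff]
    dsimp only
    rw [Nat.mod_eq_of_lt h2j, Nat.mod_eq_of_lt (by omega)]
    omega
  · have hfilter : (univ.filter fun x : Fin n =>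
        (if x.val < (n - N) + 2 * k then min (x.val / 2) (k - 1) else k) = k) =
        univ.filter fun x : Fin n => ¬ (x.val < (n - N) + 2 * k) := by
      refine Finset.filter_congr fun x _ => ?_
      constructor
      · intro h hx
        rw [if_pos hx] at h
        have := min_le_right (x.val / 2) (k - 1)
        omega
      · intro hx
        rw [if_neg hx]
    rw [hfilter]
    have h := Finset.card_filter_add_card_filter_not (s := (univ : Finset (Fin n)))
      (fun x : Fin n => x.val < (n - N) + 2 * k)
    rw [Fin.card_filter_val_lt, Finset.card_univ, Fintype.card_fin] at h
    have hmin : min n (n - N + 2 * k) = n - N + 2 * k := min_eq_right (by omega)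
    omega

/-- **`CompleteGraphAnchor`, sector form.** On `K_n`, `n ≥ 2`, for `N ≤ n` electrons and
`S^z = M = N/2 - k` with `k ≥ 1`, `M ≥ 0`, the minimum of `ℒ = ½ Σ_{x≠y} (1 - Sw x y)` over the
Gutzwiller `(N, M)` sector is `n(n-1)/2 - [(n-N+1)(n-N+2)/2 - (N/2-M-1)² - M(N-1)]`
(`= nN - 2n + N - (N-k)k - k`). Proof: the sum-of-squares identity `lap_expect_eq` bounds the
Rayleigh quotient below by the constant, and the block state of `exists_minimiser` attains it.
[folklore] -/
theorem completeGraphAnchor_fin (n : ℕ) (_hn : 2 ≤ n) (N : ℕ) (M : ℝ) (hNn : N ≤ n) (hM0 : 0 ≤ M)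
    (hM1 : M + 1 ≤ (N : ℝ) / 2) (hkex : ∃ k : ℤ, M = (N : ℝ) / 2 - k) :
    Matrix.minEnergyOn ((1 / 2 : ℂ) • ∑ x : Fin n, ∑ y : Fin n,
        (if (⊤ : SimpleGraph (Fin n)).Adj x y then (1 - siteSwap x y) else 0))
      (szSector N M ⊓ Module.End.eigenspace (Matrix.toLin'
        (gutzwillerProj : Matrix (Finset (Orb (Fin n))) (Finset (Orb (Fin n))) ℂ)) 1) =
      (n : ℝ) * ((n : ℝ) - 1) / 2 -
        (((n : ℝ) - N + 1) * ((n : ℝ) - N + 2) / 2 - ((N : ℝ) / 2 - M - 1) ^ 2 - M * ((N : ℝ) - 1)) := by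
  obtain ⟨kz, hkz⟩ := hkex
  have hkz1 : (1 : ℝ) ≤ kz := by linarith
  have hkz0 : (0 : ℤ) ≤ kz := by exact_mod_cast (le_trans zero_le_one hkz1)
  obtain ⟨k, rfl⟩ : ∃ k : ℕ, kz = k := ⟨kz.toNat, (Int.toNat_of_nonneg hkz0).symm⟩
  push_cast at hkz hkz1
  have hk1 : 1 ≤ k := by exact_mod_cast hkz1
  have hkN' : 2 * (k : ℝ) ≤ N := by linarith
  have hkN : 2 * k ≤ N := by exact_mod_cast hkN'
  -- the sector data
  set Nup : ℕ := N - k with hNup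
  set Ndn : ℕ := k with hNdn
  have hkle : k ≤ N := by omega
  have hsum : Nup + Ndn = N := by omega
  have hNupR : (Nup : ℝ) = N - k := by rw [hNup, Nat.cast_sub hkle]
  have hM2 : 2 * M = (Nup : ℝ) - Ndn := by rw [hNupR, hkz]; ring
  -- the value
  set c : ℝ := (Fintype.card (Fin n) : ℝ) * (Nup + Ndn) - 2 * (Fintype.card (Fin n)) + (Nup + Ndn) -
    Nup * Ndn - Ndn with hc
  have hval : c = (n : ℝ) * ((n : ℝ) - 1) / 2 -
      (((n : ℝ) - N + 1) * ((n : ℝ) - N + 2) / 2 - ((N : ℝ) / 2 - M - 1) ^ 2 - M * ((N : ℝ) - 1)) := by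
    rw [hc, Fintype.card_fin, hNupR, hNdn, hkz]
    ring
  rw [← hval, Matrix.minEnergyOn]
  apply IsLeast.csInf_eq
  constructor
  · -- the minimiser attains `c`
    obtain ⟨label, a, b, hlab, ha, hb, hab, hU⟩ := exists_blocks n N k hk1 hkN hNn
    obtain ⟨ψ, hψ0, hG, hN, hS, hsp, hq0, hq1⟩ := exists_minimiser label a b k hlab ha hb hab
    rw [hU] at hN hS
    have hN' : IsNParticle N ψ := by rwa [show N - 2 * k + 2 * k = N by omega] at hN
    have hS' : spinZ *ᵥ ψ = (M : ℂ) • ψ := by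
      rw [hS]
      congr 1
      rw [Nat.cast_sub hkN, hkz]
      push_cast
      ring
    -- normalise
    have hpos : 0 < (star ψ ⬝ᵥ ψ).re := by
      have h1 : 0 < star ψ ⬝ᵥ ψ :=
        lt_of_le_of_ne (dotProduct_star_self_nonneg ψ) (Ne.symm (mt dotProduct_star_self_eq_zero.1 hψ0))
      exact (Complex.pos_iff.1 h1).1
    set r : ℝ := (star ψ ⬝ᵥ ψ).re with hr
    set cst : ℂ := (((Real.sqrt r)⁻¹ : ℝ) : ℂ) with hcst
    have hcc : star cst * cst = ((r⁻¹ : ℝ) : ℂ) := by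
      rw [hcst, Complex.star_def, Complex.conj_ofReal, ← Complex.ofReal_mul, ← mul_inv,
        Real.mul_self_sqrt hpos.le]
    have hnorm : star (cst • ψ) ⬝ᵥ (cst • ψ) = 1 := by
      rw [star_smul, smul_dotProduct, dotProduct_smul, smul_smul, hcc, smul_eq_mul,
        star_dotProduct_self_eq_re ψ, ← hr, ← Complex.ofReal_mul, inv_mul_cancel₀ hpos.ne',
        Complex.ofReal_one]
    have hG1 : IsGutzwiller (cst • ψ) := fun s hs => by simp [hG s hs]
    have hN1 : IsNParticle N (cst • ψ) := fun s hs => by simp [hN' s hs]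
    have hS1 : spinZ *ᵥ (cst • ψ) = (M : ℂ) • (cst • ψ) := by rw [mulVec_smul, hS', smul_comm]
    refine ⟨cst • ψ, (mem_gutzwillerSector_iff _ N M).2 ⟨hN1, hS1, hG1⟩, hnorm, ?_⟩
    have h := (lap_re_expect hG1 hN1 hS1 hsum hM2).2
      (by rw [mulVec_smul, hsp, smul_zero]) (by rw [mulVec_smul, mulVec_smul, hq0, smul_zero])
      (by rw [mulVec_smul, mulVec_smul, hq1, smul_zero])
    rw [h, hnorm, Complex.one_re, mul_one]
  · -- lower bound
    rintro E ⟨ψ, hψ, h1, rfl⟩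
    obtain ⟨hN, hS, hG⟩ := (mem_gutzwillerSector_iff ψ N M).1 hψ
    have h := (lap_re_expect hG hN hS hsum hM2).1
    rw [h1, Complex.one_re, mul_one] at h
    exact h

end Fin

end Summit.HubbardSuperconductivity.HubbardSuperconductivity.Theorems.HyperoctahedralMott.Anchor

namespace Summit.HubbardSuperconductivity.HubbardSuperconductivity.Theorems.HyperoctahedralMott

open Literature.MathematicalPhysics.QuantumLattice

/-- **`CompleteGraphAnchor`** (route `HyperoctahedralMott`, item stmt-HubbardSuperconductivity-6677):
on the complete graph `K_n`, `n ≥ 2`, for `N ≤ n` electrons and magnetisation `M = N/2 - k ≥ 0`,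
`k ≥ 1`, the minimum over the Gutzwiller `(N, M)` sector of the fermionic interchange Laplacian
`ℒ = Σ_{x<y} (1 - π(xy))` equals `n(n-1)/2 - [(n-N+1)(n-N+2)/2 - (N/2-M-1)² - M(N-1)]`.
[folklore] -/
theorem completeGraphAnchor_proof :
    Summit.HubbardSuperconductivity.HubbardSuperconductivity.Theses.HyperoctahedralMott.CompleteGraphAnchor := by
  intro n hn Λ G Sw Lap K N M hNn hM0 hM1 hk
  exact Anchor.completeGraphAnchor_fin n hn N M hNn hM0 hM1 hk

end Summit.HubbardSuperconductivity.HubbardSuperconductivity.Theorems.HyperoctahedralMott
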